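import Summits.QuantumFields.YangMills.Theorems.ColdStartUniversalityShenZhuZhuLargeNVarianceSU2
import Summits.QuantumFields.YangMills.Theorems.ColdStartUniversalityShenZhuZhuTorusConcentrationSU2
import HarnessLib

/-!
# Shen–Zhu–Zhu's Wilson loop variable `W_ℓ = Tr(Q_{e₁}⋯Q_{e_n})` ((1.11), tree `wilsonLoopTrace`) for `SU(2)` in three dimensions: `Im W_ℓ = 0`,
# `Re W_ℓ = 2·W_C`, Gaussian concentration and variance of `Re W_ℓ` under every infinite-volume limit point and on every torus

Seat `ym-line-csu-p1` (g38), route `ColdStartUniversality` of `Summits/QuantumFields/YangMills`, helper file G16 — the seat's Wilson-loop concentration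
theorems (G5, G7) restated in the Literature's vocabulary of Shen–Zhu–Zhu's complex Wilson loop variable `wilsonLoopTrace ρ w U = Tr ρ(hol_w U)`
(`ShenZhuZhuPoincareApplications`): for `SU(2)` the trace is real, `Re W_ℓ = 2 · (½ Re tr hol)`, so

* `wilsonLoopTrace_su2_im`, `wilsonLoopTrace_su2_re` — `Im W_ℓ = 0`, `Re W_ℓ = 2 W_C` (`W_C` = `wilsonLoopObs` of the normalised character).
* ★★ `szz_wilsonLoopTrace_twoSided_su2` — every infinite-volume limit point, 't Hooft `|β| < 1/24`, every closed walk of positive length: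
  `μ{|Re W_ℓ − ⟨Re W_ℓ⟩| ≥ r} ≤ 2 exp(−(1 − 24|β|) r²/(4 Σ_e mult_ℓ(e)²))`; `szz_wilsonLoopTrace_twoSided_su2_length` — the multiplicity-free form
  `≤ 2 exp(−(1 − 24|β|) r²/(4n²))`, `n = |ℓ|` (`Σ_e mult² ≤ n²`).
* ★★ `szz_wilsonLoopTrace_variance_su2` — `Var(Re W_ℓ) ≤ 2 Σ_e mult_ℓ(e)²/(1 − 24|β|) ≤ 2n²/(1 − 24|β|)`.
* ★★ `torus_wilsonLoopTrace_twoSided_su2_uniform` — the same on every torus `(ℤ/L)³` at tree coupling `|β'| < 1/12` (links of `ℓ` distinct on the torus).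

THEOREMS ONLY, no definition, no sorry.  HONEST FRAMING: STRONG coupling, fixed lattice, `SU(2)`, `d = 3`; nothing at weak coupling / in the
continuum, nothing `K`-uniform along the route's scaling (`UniformColdStartMixing`, 24809, ASIDE, not restated); no crux, rung or summit statement is
proved; the Yang–Mills mass gap is NOT proved.

References: H. Shen, R. Zhu, X. Zhu, CMP 400 (2023) 805–851 = arXiv:2204.12737, (1.11), Thm 1.4, Cor. 1.5 [ShenZhuZhu2022].
-/

set_option autoImplicit false

noncomputable section

namespace Summit.QuantumFields.YangMills.Theorems.ColdStartUniversality

open MeasureTheory ProbabilityTheory Finset Filter Set Function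
open scoped BigOperators NNReal ENNReal Topology Matrix Matrix.Norms.Frobenius ContDiff
open SimpleGraph
open Literature.Probability.LatticeModels (Site zdGraph)
open Literature.Probability.Process Literature.MathematicalPhysics.QuantumFieldTheory
open Literature.MathematicalPhysics.QuantumLattice (fundamentalRep fundamentalLatticeRep continuous_fundamentalRep fundamentalRep_apply
  torusEdge torusLift infiniteVolumeLimitPoints LGConfig normalisedCharacter walkHolonomy wilsonLoopObs loopExpectation)
open Summit.Ventures.YMGap.RobustBall (dartMult)

/-! ## §1. `Im W_ℓ = 0` and `Re W_ℓ = 2 W_C` for `SU(2)` -/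

/-- For `SU(2)` the Wilson loop variable `W_ℓ = Tr hol_ℓ` is real. [folklore] -/
theorem wilsonLoopTrace_su2_im {d : ℕ} {x : Site d} (w : (zdGraph d).Walk x x)
    (U : LGConfig d (Matrix.specialUnitaryGroup (Fin 2) ℂ)) :
    (wilsonLoopTrace (fundamentalRep (Fin 2)) w U).im = 0 := by
  rw [wilsonLoopTrace_apply, fundamentalRep_apply]
  exact Literature.MathematicalPhysics.QuantumLattice.NarrowWell.trace_im_eq_zero _

/-- `Re W_ℓ = 2 · W_C` for `SU(2)`: the real part of the Wilson loop variable is twice the Wilson loop observable of the normalised fundamental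
character. [folklore] -/
theorem wilsonLoopTrace_su2_re {d : ℕ} {x : Site d} (w : (zdGraph d).Walk x x)
    (U : LGConfig d (Matrix.specialUnitaryGroup (Fin 2) ℂ)) :
    (wilsonLoopTrace (fundamentalRep (Fin 2)) w U).re =
      2 * wilsonLoopObs (fun g : Matrix.specialUnitaryGroup (Fin 2) ℂ => normalisedCharacter 2 (fundamentalRep (Fin 2) g)) w U := by
  unfold wilsonLoopObs normalisedCharacter wilsonLoopTrace
  push_cast
  ring

/-! ## §2. Infinite-volume limit points, 't Hooft `|β| < 1/24` -/

/-- ★★ **Gaussian concentration of `Re W_ℓ` under every infinite-volume limit point** of `SU(2)` lattice Yang–Mills on `ℤ³` at 't Hooft coupling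
`|β| < 1/24`: for every closed walk `ℓ` of positive length and `r ≥ 0`, `μ{|Re W_ℓ − ⟨Re W_ℓ⟩_μ| ≥ r} ≤ 2 exp(−(1 − 24|β|) r²/(4 Σ_e mult_ℓ(e)²))`.
The Yang–Mills mass gap is NOT proved. [cite: ShenZhuZhu2022, Theorem 1.4, Corollary 1.5] -/
theorem szz_wilsonLoopTrace_twoSided_su2 {β : ℝ} (hβ : |β| < 1 / 24)
    {μ : Measure (LGConfig 3 (Matrix.specialUnitaryGroup (Fin 2) ℂ))}
    (hμ : μ ∈ infiniteVolumeLimitPoints (d := 3) (fundamentalRep (Fin 2)) (((2 : ℕ) : ℝ) * β))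
    {x : Site 3} (w : (zdGraph 3).Walk x x) (hw : 0 < w.length) {r : ℝ} (hr : 0 ≤ r) :
    μ.real {U | r ≤ |(wilsonLoopTrace (fundamentalRep (Fin 2)) w U).re - ∫ V, (wilsonLoopTrace (fundamentalRep (Fin 2)) w V).re ∂μ|} ≤
      2 * Real.exp (-((1 - 24 * |β|) * r ^ 2 / (4 * ∑ e ∈ walkEdges w, (dartMult w e : ℝ) ^ 2))) := by
  have hr2 : 0 ≤ r / 2 := by linarith
  have h := szz_wilsonLoop_twoSided_su2 hβ hμ w hw hr2
  have hset : {U : LGConfig 3 (Matrix.specialUnitaryGroup (Fin 2) ℂ) |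
        r ≤ |(wilsonLoopTrace (fundamentalRep (Fin 2)) w U).re - ∫ V, (wilsonLoopTrace (fundamentalRep (Fin 2)) w V).re ∂μ|} =
      {U | r / 2 ≤ |wilsonLoopObs (fun g : Matrix.specialUnitaryGroup (Fin 2) ℂ => normalisedCharacter 2 (fundamentalRep (Fin 2) g)) w U -
        loopExpectation μ (fun g : Matrix.specialUnitaryGroup (Fin 2) ℂ => normalisedCharacter 2 (fundamentalRep (Fin 2) g)) w|} := by
    ext U
    simp only [mem_setOf_eq, wilsonLoopTrace_su2_re, integral_const_mul, loopExpectation]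
    rw [← mul_sub, abs_mul, abs_of_pos (by norm_num : (0 : ℝ) < 2)]
    constructor <;> intro h' <;> linarith
  rw [hset]
  refine h.trans (le_of_eq ?_)
  congr 2
  ring

/-- The multiplicity-free form: `μ{|Re W_ℓ − ⟨Re W_ℓ⟩_μ| ≥ r} ≤ 2 exp(−(1 − 24|β|) r²/(4n²))`, `n = |ℓ| ≥ 1` (`Σ_e mult_ℓ(e)² ≤ n²`).
The Yang–Mills mass gap is NOT proved. [cite: ShenZhuZhu2022, Theorem 1.4, Corollary 1.5] -/
theorem szz_wilsonLoopTrace_twoSided_su2_length {β : ℝ} (hβ : |β| < 1 / 24)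
    {μ : Measure (LGConfig 3 (Matrix.specialUnitaryGroup (Fin 2) ℂ))}
    (hμ : μ ∈ infiniteVolumeLimitPoints (d := 3) (fundamentalRep (Fin 2)) (((2 : ℕ) : ℝ) * β))
    {x : Site 3} (w : (zdGraph 3).Walk x x) (hw : 0 < w.length) {r : ℝ} (hr : 0 ≤ r) :
    μ.real {U | r ≤ |(wilsonLoopTrace (fundamentalRep (Fin 2)) w U).re - ∫ V, (wilsonLoopTrace (fundamentalRep (Fin 2)) w V).re ∂μ|} ≤
      2 * Real.exp (-((1 - 24 * |β|) * r ^ 2 / (4 * (w.length : ℝ) ^ 2))) := by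
  have hK : 0 < 1 - 24 * |β| := by linarith
  have hS : 0 < ∑ e ∈ walkEdges w, (dartMult w e : ℝ) ^ 2 := by
    have h1 := length_le_sum_dartMult_sq w
    have h0 : (0 : ℝ) < w.length := by exact_mod_cast hw
    linarith
  refine (szz_wilsonLoopTrace_twoSided_su2 hβ hμ w hw hr).trans ?_
  refine mul_le_mul_of_nonneg_left (Real.exp_le_exp.2 ?_) (by norm_num)
  rw [neg_le_neg_iff]
  refine div_le_div_of_nonneg_left (by positivity) (by positivity) ?_
  exact mul_le_mul_of_nonneg_left (sum_dartMult_sq_le_length_sq w) (by norm_num)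

/-- ★★ **Variance of `Re W_ℓ` under every infinite-volume limit point**, 't Hooft `|β| < 1/24`: `Var_μ(Re W_ℓ) ≤ 2 Σ_e mult_ℓ(e)²/(1 − 24|β|)` for every
closed walk `ℓ`.  The Yang–Mills mass gap is NOT proved. [cite: ShenZhuZhu2022, Corollary 1.5] -/
theorem szz_wilsonLoopTrace_variance_su2 {β : ℝ} (hβ : |β| < 1 / 24)
    {μ : Measure (LGConfig 3 (Matrix.specialUnitaryGroup (Fin 2) ℂ))}
    (hμ : μ ∈ infiniteVolumeLimitPoints (d := 3) (fundamentalRep (Fin 2)) (((2 : ℕ) : ℝ) * β))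
    {x : Site 3} (w : (zdGraph 3).Walk x x) :
    Var[fun U => (wilsonLoopTrace (fundamentalRep (Fin 2)) w U).re; μ] ≤
      2 * (∑ e ∈ walkEdges w, (dartMult w e : ℝ) ^ 2) / (1 - 24 * |β|) := by
  have hfun : (fun U : LGConfig 3 (Matrix.specialUnitaryGroup (Fin 2) ℂ) => (wilsonLoopTrace (fundamentalRep (Fin 2)) w U).re) =
      fun U => 2 * wilsonLoopObs (fun g : Matrix.specialUnitaryGroup (Fin 2) ℂ => normalisedCharacter 2 (fundamentalRep (Fin 2) g)) w U :=
    funext fun U => wilsonLoopTrace_su2_re w U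
  rw [hfun, variance_const_mul]
  have h := szz_wilsonLoop_variance_su2 hβ hμ w
  have hK : 0 < 1 - 24 * |β| := by linarith
  calc (2 : ℝ) ^ 2 * Var[wilsonLoopObs (fun g : Matrix.specialUnitaryGroup (Fin 2) ℂ => normalisedCharacter 2 (fundamentalRep (Fin 2) g)) w; μ]
      ≤ 2 ^ 2 * ((∑ e ∈ walkEdges w, (dartMult w e : ℝ) ^ 2) / (2 * (1 - 24 * |β|))) := mul_le_mul_of_nonneg_left h (by norm_num)
    _ = 2 * (∑ e ∈ walkEdges w, (dartMult w e : ℝ) ^ 2) / (1 - 24 * |β|) := by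
        field_simp

/-! ## §3. Every torus, tree coupling `|β'| < 1/12` -/

/-- ★★ **Gaussian concentration of `Re W_ℓ` on every torus, uniformly in the volume**: for the periodic `SU(2)` Wilson measure on `(ℤ/L)³` at tree
coupling `|β'| < 1/12`, every closed walk `ℓ` of positive length whose links stay distinct on the torus (read through the periodic lift) and `r ≥ 0`:
`μ_{L,β'}{|Re W_ℓ − ⟨Re W_ℓ⟩| ≥ r} ≤ 2 exp(−(1 − 12|β'|) r²/(4 Σ_e mult_ℓ(e)²))`.  The Yang–Mills mass gap is NOT proved. [cite: ShenZhuZhu2022, Theorem 1.4] -/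
theorem torus_wilsonLoopTrace_twoSided_su2_uniform {β' : ℝ} (hβ : |β'| < 1 / 12) (L : ℕ) [NeZero L]
    {x : Site 3} (w : (zdGraph 3).Walk x x) (hinj : Set.InjOn (torusEdge (d := 3) L) ↑(walkEdges w)) (hw : 0 < w.length)
    {r : ℝ} (hr : 0 ≤ r) :
    ((wilsonMeasure (d := 3) (L := L) (fundamentalRep (Fin 2)) β')).real {V | r ≤ |(wilsonLoopTrace (fundamentalRep (Fin 2)) w (torusLift L V)).re -
        ∫ V', (wilsonLoopTrace (fundamentalRep (Fin 2)) w (torusLift L V')).re ∂(wilsonMeasure (d := 3) (L := L) (fundamentalRep (Fin 2)) β')|} ≤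
      2 * Real.exp (-((1 - 12 * |β'|) * r ^ 2 / (4 * ∑ e ∈ walkEdges w, (dartMult w e : ℝ) ^ 2))) := by
  have hr2 : 0 ≤ r / 2 := by linarith
  have h := torus_wilsonLoop_twoSided_su2_uniform hβ L w hinj hw hr2
  have hset : {V : (GaugeConfig 3 L (Matrix.specialUnitaryGroup (Fin 2) ℂ)) | r ≤ |(wilsonLoopTrace (fundamentalRep (Fin 2)) w (torusLift L V)).re -
        ∫ V', (wilsonLoopTrace (fundamentalRep (Fin 2)) w (torusLift L V')).re ∂(wilsonMeasure (d := 3) (L := L) (fundamentalRep (Fin 2)) β')|} =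
      {V | r / 2 ≤ |wilsonLoopObs (fun g : Matrix.specialUnitaryGroup (Fin 2) ℂ => normalisedCharacter 2 (fundamentalRep (Fin 2) g)) w
          (torusLift L V) -
        ∫ V', wilsonLoopObs (fun g : Matrix.specialUnitaryGroup (Fin 2) ℂ => normalisedCharacter 2 (fundamentalRep (Fin 2) g)) w
          (torusLift L V') ∂(wilsonMeasure (d := 3) (L := L) (fundamentalRep (Fin 2)) β')|} := by
    ext V
    simp only [mem_setOf_eq, wilsonLoopTrace_su2_re, integral_const_mul]
    rw [← mul_sub, abs_mul, abs_of_pos (by norm_num : (0 : ℝ) < 2)]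
    constructor <;> intro h' <;> linarith
  rw [hset]
  refine h.trans (le_of_eq ?_)
  congr 2
  ring

end Summit.QuantumFields.YangMills.Theorems.ColdStartUniversality

end
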